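import Literature.Claims.NS.ZgurovskyKasyanov2012

/-!
# CLAIM C42 — A. Bazarbekov, «Existence and smoothness of the solution to the Navier-Stokes
# equation» (arXiv:2002.05360 [math.GM])

VERSION TYPED: **v1 (2020-02-13, 24 pp.) — the only version** (TeX `v1-2020-02-13-bai_3.tex`, 1451
lines, cp1251, statements in-line bold, equations hand-numbered «(2,20)» = (2.20); PDF page texts
`v1-pages/p001–p024.txt` for page location only; all quotes below are from the TeX; files under
`run/shared/lean/pub/ns-claims/sources/Bazarbekov2020/arxiv-2002.05360/`, LOCATORS by ns-claims-lit-2;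
locator convention «TeX l.N / p.M»). Companion arXiv:2002.12726 (= ref. [12], linear estimates) is
cited by the text for (2,16)–(2,17) and enters only as the content of the hypotheses of Step 1a.
Bib key `Bazarbekov2020`. MSC printed 35K55, 46E35; the words «Millennium»/«Clay» do not occur; the
framing is the abstract l.35 / intro l.152–153 «A fundamental problem in analysis is to decide whether a
smooth solution exists for the Navier-Stokes equations in three dimensions» and Remark 2.1 l.223–234
(Problem 1 = Ladyzhenskaya's 2003 formulation [6] of «the sixth millennium problem»).

WHAT THIS FILE IS: a step-wise typing, at the paper's own grain, of the CLAIMED proof that the forced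
Navier–Stokes initial-boundary value problem on a BOUNDED domain with homogeneous Dirichlet condition
and zero initial datum has, for EVERY `f ∈ L₂(Q_t)` and every `t > 0`, `ρ > 0`, a unique strong solution
`u ∈ W₂^{2,1}(Q_t) ∩ H₂(Q_t)` (Theorem 2.1; Theorem 4.1 for a datum `a ∈ W₂¹(Ω)`). The headline is the
`def` `ClaimedTheorem`; each printed load-bearing assertion is a `def Step… : Prop`; `claim_of_steps`
(PROVED) composes them in the paper's own order. Nothing here asserts that any Step holds.

WHAT THIS IS NOT: not a claim about NS regularity or blow-up; not an endorsement of any Step; not a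
claim about any statement of the author beyond the typed locators of v1.

## Claimed statements (as printed)

* Setting, §2 l.157–174 / p.2: «Let `Ω ⊂ R³` be a finite domain bounded by the Lipchitz surface `∂Ω`.
  `Q_t = Ω × [0,t]` … Here `t > 0` is an arbitrary real number.» The system **(2.1)**
  `∂u_i/∂t − ρΔu_i − Σ_j u_j ∂u_i/∂x_j + ∂p/∂x_i = f_i(x,t)`, `div u = 0` — NOTE the printed MINUS sign
  of the convective term (typed as printed; `u ↦ −u`, `p ↦ −p`, `f ↦ −f` maps it to the usual sign, so
  nothing depends on it) — and **«The Navier-Stokes problem 1.»** find `u : Ω × [0,t] → R³`, `p` with (2.1)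
  and «`u(x,0) = 0`, `u(x,t)|_{∂Ω×[0,t]} = 0` (2.2)». Spaces l.175–208: `W₂^{2,1}(Q_t)` with norm
  `[‖u‖² + ‖u_t‖² + ‖u_x‖² + ‖u_xx‖²]^{1/2}` (all `L₂(Q_t)`), `H₂(Q_t) = {u ∈ L₂(Q_t) : div u = 0, u·n|_{∂Ω} = 0}`;
  vector norms are SUMS over components (l.184–186).
* **Theorem 2.1** (l.209–218 / p.3, «principal result»): «For any right-hand side `f(x,t) ∈ L₂(Q_t)` in
  equation (2.1) and for any real numbers `ρ > 0`, `t > 0`, the Navier-Stokes problem-1 has a unique smooth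
  solution `u(x,t) : u(x,t) ∈ W₂^{2,1}(Q_t) ∩ H₂(Q_t)` and a scalar function `p(x,t): p_{x_i}(x,t) ∈ L₂(Q_t)`
  satisfying (2.1) almost everywhere on `Q_t`, and the following estimates are valid:
  `‖u‖_{W₂^{2,1}(Q_t)} ≤ c‖f‖_{L₂(Q_t)}`, `‖∂p/∂x_i‖_{L₂(Q_t)} ≤ c‖f‖_{L₂(Q_t)}` (2.3)» — `c` «a generic
  constant, independent on the solution and right-hand side» (l.219–221); «smooth» := Definition 2.1
  (l.236–240): `u ∈ W₂^{2,1} ∩ H₂`, `p_{x_i} ∈ L₂`.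
* **Theorem 2.2** (l.565–577 / p.8; Problem 2 l.555 = the Volterra system (2,20) for
  `w := u_t − ρΔu + ∇p = f + (u·∇)u` [(2,15) prints the pressure term with «−»; (2.1)/(2,20) fix it]):
  unique `w ∈ L₂(Q_T)` solving (2,20) for every `f ∈ L₂(Q_T)`, «And for any possible solution `w` …
  `‖w(t)‖_{L₂(0,T)} < ∞` … the following a priori estimate is valid `‖w‖_{L₂(Q_T)} < √2·‖f‖_{L₂(Q_T)}` (2.21)».
* **Theorem 3.1** (l.714–719 / p.11, «key proposition»): «For all functions `w(t) ∈ L₂(0,T)` satisfying the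
  inequality (3,4) the following estimate holds: `‖w(t)‖_{L₂(0,T)} < √2·‖f(t)‖_{L₂(0,T)}` (3,5). This
  estimate does not depends on the number `b₁` in (3,4).» Here **(3,4)** (Lemma 3.2, l.653–658 / p.10) is
  `w(t) < f(t) + b₁·∫₀ᵗ w²(τ)(t − τ)^{−μ} dτ`, `μ ∈ [5/8, 3/4)` (Lemma 3.1 l.599: `5/8 ≤ μ < 1`; Remark 3-1
  l.637–638: «Note that `μ: 5/8 ≤ μ < 3/4`»), `w, f ≥ 0` ((3.2') l.621–627).
* **Theorem 4.1** (l.1245–1256 / p.20–21): the same for the datum `u(x,0) = a(x)`, `div a = 0`,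
  `a ∈ W₂¹(Ω)` (4.2), with (4.3) `‖u‖_{W₂^{2,1}(Q_t)} + ‖∂p/∂x_i‖_{L₂(Q_t)} ≤ c(‖f‖_{L₂(Q_t)} + ‖a‖_{W₂¹(Ω)})`.

## Architecture of the printed proof and ordered Step index (print order)

§2 (2,15)–(2,20), p.7–8: with the parabolic Green function `G` of `Q_t` and the pressure operator `P`
of [12] ((2,16)–(2,18), bound (2,17) `∫₀ᵗ Σ‖∂p/∂x_i‖² < c∫₀ᵗ Σ‖w_i‖²`), `u = G(w + Pw)` (2,19) and NS
becomes the Volterra system (2,20) for `w ∈ L₂(Q_t)`. §3: Lemma 3.1 (3.1) l.588–612 / p.8–9 (quadratic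
Green bound) ⇒ **(3,2)** l.614–627 / p.9: `w(t) < f(t) + b(∫₀ᵗ (w(τ) + p(τ))(t − τ)^{−μ}dτ)²` for every
solution, `w(τ) = Σ_i‖w_i(·,τ)‖_{L₂(Ω)}`, `p(τ) = Σ_i‖∂p/∂x_i(·,τ)‖_{L₂(Ω)}`, `f(t) = Σ_i‖f_i(·,t)‖_{L₂(Ω)}`;
Remark 3-1 l.629–650 (bold, l.645–650): «Below (see Theorem 3.1), we shall prove that for ALL functions
`w(t), p(t) ∈ L₂(0,T): ‖p(t)‖_{L₂(0,T)} < c‖w(t)‖_{L₂(0,T)} < ∞`, satisfying the inequality (3,2), the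
following a priori estimate: `‖w(t)‖_{L₂(0,T)} < √2‖f(t)‖_{L₂(0,T)}` holds» — the author's own licence
for the abstract (all-functions) grain of Steps 1b and 2; **Lemma 3.2** l.653–691 / p.10: (3,4')
`w(t) < f(t) + b₁∫₀ᵗ (w² + p²)(t − τ)^{−μ}dτ`, `∫₀ᵗ p² < c∫₀ᵗ w²`, then **(3,4'')** l.679–691 «We shall
prove by the second inequality of (3,4') that there exists a constant `c > 0`:
`∫₀ᵗ p²(τ)(t − τ)^{−μ}dτ < c·∫₀ᵗ w²(τ)(t − τ)^{−μ}dτ`» (argued «by contradiction» applying `J^{1−μ}`),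
whence (3,4); Remark 3-2 / Riccati l.699–712; **Theorem 3.1** l.714–719 / p.11 with proof l.720–1075 /
pp.11–18 (substitution (3,6), squaring (3,7), free parameter `k` (3,8), Mellin-transform sign claim (3,9)
«for all numbers `k ≫ 1`», Riccati substitution (3,11), Lemmas 3.3, 3-4, 3,5', limits `μ → 1`, `n → ∞`
(3,37)); **Lemma 3.4** l.1098–1168 / p.18–19 (the operator `K` of (2,20) is compact on `L₂(Q_t)`);
**proof of Theorem 2.1** l.1170–1216 / p.19–20: `K_p` compact ⇒ «by the Leray-Schauder's theorem in
Proposition 6 … (2,20) has at least one solution `w ∈ L₂(Q_t)` and it follows from Theorem 3.1 that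
`‖w‖ ≤ √2‖f‖` … by Proposition 8 … there exists the smooth solution `u ∈ W₂^{2,1}(Q_T) ∩ H₂(Q_t)` … unique
[3 p.139]». §4 l.1220–1372 / p.20–22: Theorem 4.1 via Hopf's weak solution and §3.

* `Step1a_Ineq32_34prime`  — (3,2) + the second inequality of (3,4') for solutions (l.614–627, 659–678; p.9–10).
* `Step1b_Ineq34pp`        — **(3,4'') as printed, abstract grain** (l.679–691 / p.10): unweighted ⇒ weighted.
* `Step1_Lemma32`          — Lemma 3.2's conclusion (3,4) for solutions, `b₁` independent of the solution (l.653–658 / p.10).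
* `Step2_Theorem31`        — **Theorem 3.1 (3,5), abstract grain as printed** (l.714–719 / p.11).
* `Step3_LeraySchauder`    — Lemma 3.4 + Proposition 6 (Leray–Schauder) + Proposition 8 + uniqueness ⇒ Theorem 2.1
                             (l.1098–1216 / p.18–20), typed as the printed implication from Steps 1–2.
* `Step4_Section4`         — §4 (l.1258–1372 / p.21–22): Hopf + heat flow + «From the Theorem 3.1 … similarly»
                             ⇒ Theorem 4.1, typed as the printed implication from Step 2.

TYPING NOTES. (i) The function spaces `W₂^{2,1}(Q_t)`, `H₂(Q_t)`, the Green function and the operator `P`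
are not in the tree; the solution notion is therefore rendered CLASSICALLY (`SolvesIBVP`: `C²` in `x` and
differentiable in `t` on `(0,T] × Ω`, the equation pointwise there, `div u = 0`, `u = 0` off `Ω`, the datum
at `t = 0`, square-integrability of `u, u_t, ∇u, ∇²u, ∇p` over `Q_T`), the domain class is NARROWED to
bounded `C^∞`-domains (`ZgurovskyKasyanov2012.IsSmoothDomain` ⊂ Lipschitz) and the forcing class to `C^∞`
forces compactly supported in `(0,T) × Ω` (⊂ `L₂(Q_t)`; for such data the printed strong solution is
classical, so the rendering is implied by the print), uniqueness is not repeated — every such choice makes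
`Theorem21`/`Theorem41` WEAKER than printed. (ii) Steps 1b and 2 are typed over ALL non-negative functions
in `L₂(0,T)` exactly as printed and as licensed by l.645–650; `b₁ > 0`, `c > 0` are arbitrary there («does
not depend on the number `b₁`»). (iii) Strict «<» is kept in the abstract Steps 1b/2 (hypothesis and
conclusion, as printed); the solution-level inequalities of Steps 1a/1 are typed with «≤» (the printed «<»
fails for the trivial solution `u ≡ 0`, `f ≡ 0` — a typo-level point nobody should adjudicate).
(iv) `L₂(Ω)`-sizes of vector fields follow the print's component-sum convention `cn` ((3.2'), l.184–186);
the `W₂^{2,1}`-size `nW21` is rendered with Euclidean pointwise norms (equivalent up to a factor absorbed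
in the generic `c`). (v) Integrals `∫₀ᵗ … (t − τ)^{−μ} dτ` are Lebesgue integrals over `Ioo 0 t` with
`Real.rpow` (base `t − τ > 0` there).

## Clay delta (reference `Literature/Claims/NS/ClayVariants.lean`; facts, not adjudication)

No Clay variant is printed or implied. Δ1 DOMAIN: bounded (Lipschitz) `Ω` with homogeneous Dirichlet
condition — (A)/(C) are on `ℝ³` with decay (4)–(5), (B)/(D) on `ℝ³/ℤ³`. Δ2 DATA: `u(·,0) = 0` (§2) or
`a ∈ W₂¹(Ω)` (§4) vs smooth divergence-free data with decay / periodic. Δ3 FORCE: arbitrary `f ∈ L₂(Q_t)`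
((A)/(B): `f ≡ 0`). Δ4 CLASS: strong `W₂^{2,1} ∩ H₂`, not `C^∞`. Δ5 `ρ > 0` arbitrary «=». Δ6 uniqueness
claimed. Even a correct Theorem 2.1/4.1 would be the (open) global strong solvability of the forced 3D
Dirichlet problem, not (A)–(D); no reduction is printed ⇒ `clay_of_claimed` is NOT provable from the text;
the missing bridge is recorded as `ClayDelta` (not asserted).
-/

open Set Function MeasureTheory Filter Topology
open scoped ContDiff ENNReal NNReal Laplacian

namespace Literature.Claims.NS.Bazarbekov2020

open Literature.Analysis.FluidPDE
open Literature.Claims.NS.ZgurovskyKasyanov2012 (E3 IsSmoothDomain InCalV tderiv)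

/-! ## Vocabulary (concrete) -/

/-- The print's `L₂(Ω)`-size of a vector field, SUM over components: `Σ_i (∫_Ω g_i² dx)^{1/2}`
((3.2') l.621–627; l.184–186). [cite: Bazarbekov2020, (3.2') l.621–627] -/
noncomputable def cn (Ω : Set E3) (g : E3 → E3) : ℝ :=
  ∑ i : Fin 3, Real.sqrt (∫ x in Ω, (g x i) ^ 2)

/-- The print's `L₂(Q_T)`-size of a time-dependent vector field: `Σ_i ‖g_i‖_{L₂(Q_T)}` (l.184–186,
l.203–206). [cite: Bazarbekov2020, §2 l.184–206] -/
noncomputable def nQ (Ω : Set E3) (T : ℝ) (g : ℝ → E3 → E3) : ℝ :=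
  ∑ i : Fin 3, Real.sqrt (∫ t in Ioc 0 T, ∫ x in Ω, (g t x i) ^ 2)

/-- The `W₂^{2,1}(Q_T)`-size `[‖u‖² + ‖u_t‖² + ‖u_x‖² + ‖u_xx‖²]^{1/2}` (l.178–181), rendered with Euclidean
pointwise norms of `u, ∂ₜu, ∇u, ∇²u` (classical derivatives). [cite: Bazarbekov2020, §2 l.178–181] -/
noncomputable def nW21 (Ω : Set E3) (T : ℝ) (u : ℝ → E3 → E3) : ℝ :=
  Real.sqrt (∫ t in Ioc 0 T, ∫ x in Ω,
    (‖u t x‖ ^ 2 + ‖tderiv u t x‖ ^ 2 + ‖fderiv ℝ (u t) x‖ ^ 2 + ‖iteratedFDeriv ℝ 2 (u t) x‖ ^ 2))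

/-- The `W₂¹(Ω)`-size of a datum `a` ((4.3) l.1253–1256), Euclidean rendering.
[cite: Bazarbekov2020, (4.2)–(4.3) l.1240–1256] -/
noncomputable def nW1 (Ω : Set E3) (a : E3 → E3) : ℝ :=
  Real.sqrt (∫ x in Ω, (‖a x‖ ^ 2 + ‖fderiv ℝ a x‖ ^ 2))

/-- ADMISSIBLE FORCING (narrowed data class, see TYPING NOTES (i)): `f` jointly `C^∞` with compact support
inside `(0,T) × Ω` — a subclass of the printed «any right-hand side `f ∈ L₂(Q_t)`».
[cite: Bazarbekov2020, Thm 2.1 l.209–211] -/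
def AdmissibleForce (Ω : Set E3) (T : ℝ) (f : ℝ → E3 → E3) : Prop :=
  ContDiff ℝ (⊤ : ℕ∞) (uncurry f) ∧ HasCompactSupport (uncurry f) ∧ tsupport (uncurry f) ⊆ Ioo 0 T ×ˢ Ω

/-- SOLUTION OF PROBLEM 1 on `Q_T = Ω × [0,T]` with datum `a` (classical rendering of «smooth solution»,
Definition 2.1 l.236–240, of (2.1)–(2.2) / (4.1)–(4.2)): `C²` in `x` and differentiable in `t` on
`(0,T] × Ω`; the printed system (2.1) pointwise there, WITH ITS PRINTED SIGN of the convective term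
`∂ₜu − ρΔu − (u·∇)u + ∇p = f`; `div u = 0`; `u(t,·)` continuous and `= 0` off `Ω` (Dirichlet);
`u(0,·) = a`; `u, ∂ₜu, ∇u, ∇²u` and `∇p` square-integrable over `Q_T` (the memberships `u ∈ W₂^{2,1}(Q_T)`,
`p_{x_i} ∈ L₂(Q_T)`). [cite: Bazarbekov2020, (2.1)–(2.2) l.163–174, Def 2.1 l.236–240, (4.1)–(4.2) l.1229–1243] -/
structure SolvesIBVP (Ω : Set E3) (ρ T : ℝ) (f : ℝ → E3 → E3) (a : E3 → E3) (u : ℝ → E3 → E3)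
    (p : ℝ → E3 → ℝ) : Prop where
  reg : ∀ t ∈ Ioc 0 T, ContDiffOn ℝ 2 (u t) Ω ∧ ContDiffOn ℝ 1 (p t) Ω ∧
    ∀ x ∈ Ω, DifferentiableAt ℝ (fun s => u s x) t
  eq : ∀ t ∈ Ioc 0 T, ∀ x ∈ Ω,
    tderiv u t x - ρ • Δ (u t) x - convect (u t) (u t) x + gradient (p t) x = f t x
  divFree : ∀ t ∈ Icc 0 T, ∀ x ∈ Ω, VectorCalculus.divergence (u t) x = 0
  bc : ∀ t ∈ Icc 0 T, Continuous (u t) ∧ ∀ x, x ∉ Ω → u t x = 0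
  ic : u 0 = a
  sqInt_u : IntegrableOn (fun q : ℝ × E3 =>
      ‖u q.1 q.2‖ ^ 2 + ‖tderiv u q.1 q.2‖ ^ 2 + ‖fderiv ℝ (u q.1) q.2‖ ^ 2 +
        ‖iteratedFDeriv ℝ 2 (u q.1) q.2‖ ^ 2) (Ioc 0 T ×ˢ Ω)
  sqInt_p : IntegrableOn (fun q : ℝ × E3 => ‖gradient (p q.1) q.2‖ ^ 2) (Ioc 0 T ×ˢ Ω)

/-- `w(t) = Σ_i ‖w_i(·,t)‖_{L₂(Ω)}` of a solution, `w := u_t − ρΔu + ∇p = f + (u·∇)u` by (2.1)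
((2,15)/(2,20) l.458–541; (3.2') l.621–624). [cite: Bazarbekov2020, (2,15)–(2,20) l.458–541, (3.2') l.621–624] -/
noncomputable def wOf (Ω : Set E3) (f u : ℝ → E3 → E3) (t : ℝ) : ℝ :=
  cn Ω (fun x => f t x + convect (u t) (u t) x)

/-- `f(t) = Σ_i ‖f_i(·,t)‖_{L₂(Ω)}` ((3.2') l.625–627). [cite: Bazarbekov2020, (3.2') l.625–627] -/
noncomputable def fOf (Ω : Set E3) (f : ℝ → E3 → E3) (t : ℝ) : ℝ := cn Ω (f t)

/-- `p(t) = Σ_i ‖∂p/∂x_i(·,t)‖_{L₂(Ω)}` ((3.2') l.625). [cite: Bazarbekov2020, (3.2') l.625] -/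
noncomputable def pOf (Ω : Set E3) (p : ℝ → E3 → ℝ) (t : ℝ) : ℝ := cn Ω (fun x => gradient (p t) x)

/-- The inequality **(3,4)** on `(0,T]`: `w(t) < f(t) + b₁·∫₀ᵗ w²(τ)(t − τ)^{−μ} dτ` (strict, as printed).
[cite: Bazarbekov2020, (3,4) l.653–658] -/
def Ineq34 (μ b₁ T : ℝ) (w f : ℝ → ℝ) : Prop :=
  ∀ t ∈ Ioc 0 T, w t < f t + b₁ * ∫ τ in Ioo 0 t, w τ ^ 2 * (t - τ) ^ (-μ)

/-- `‖g‖_{L₂(0,T)}`. [cite: Bazarbekov2020, (3,5) l.717] -/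
noncomputable def l2 (T : ℝ) (g : ℝ → ℝ) : ℝ := Real.sqrt (∫ t in Ioo 0 T, g t ^ 2)

/-! ## The claimed theorems -/

/-- **Theorem 2.1** (l.209–218 / p.3) in the classical, narrowed rendering of TYPING NOTES (i): for every
bounded `C^∞`-domain `Ω`, every `ρ > 0`, `T > 0` there is a constant `c` such that for every admissible
force `f` Problem 1 (zero datum) has a solution on `Q_T` with the estimates (2.3)
`‖u‖_{W₂^{2,1}(Q_T)} ≤ c‖f‖_{L₂(Q_T)}`, `‖∇p‖_{L₂(Q_T)} ≤ c‖f‖_{L₂(Q_T)}` (uniqueness, printed, not repeated).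
[cite: Bazarbekov2020, Thm 2.1 l.209–221] -/
def Theorem21 : Prop :=
  ∀ Ω : Set E3, IsSmoothDomain Ω → ∀ ρ T : ℝ, 0 < ρ → 0 < T →
    ∃ c : ℝ, ∀ f : ℝ → E3 → E3, AdmissibleForce Ω T f →
      ∃ (u : ℝ → E3 → E3) (p : ℝ → E3 → ℝ), SolvesIBVP Ω ρ T f 0 u p ∧
        nW21 Ω T u ≤ c * nQ Ω T f ∧ nQ Ω T (fun t x => gradient (p t) x) ≤ c * nQ Ω T f

/-- **Theorem 4.1** (l.1245–1256 / p.20–21), same rendering, datum `a ∈ C₀^∞(Ω)³` divergence free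
(`ZgurovskyKasyanov2012.InCalV`, a subclass of the printed `a ∈ W₂¹(Ω)`, `div a = 0`), estimate (4.3);
§4 derives it from Theorem 3.1 again (Step 4). [cite: Bazarbekov2020, Thm 4.1 l.1245–1256] -/
def Theorem41 : Prop :=
  ∀ Ω : Set E3, IsSmoothDomain Ω → ∀ ρ T : ℝ, 0 < ρ → 0 < T →
    ∃ c : ℝ, ∀ (f : ℝ → E3 → E3) (a : E3 → E3), AdmissibleForce Ω T f → InCalV Ω a →
      ∃ (u : ℝ → E3 → E3) (p : ℝ → E3 → ℝ), SolvesIBVP Ω ρ T f a u p ∧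
        nW21 Ω T u + nQ Ω T (fun t x => gradient (p t) x) ≤ c * (nQ Ω T f + nW1 Ω a)

/-- THE CLAIMED THEOREM = Theorem 2.1 (the «principal result», zero datum) together with Theorem 4.1
(datum `a`). A `def`, never a `theorem`. [cite: Bazarbekov2020, Thm 2.1 l.209–218, Thm 4.1 l.1245–1256] -/
def ClaimedTheorem : Prop := Theorem21 ∧ Theorem41

/-! ## Steps, in the order of the printed proof -/

/-- **Step 1a — (3,2) (l.614–627 / p.9) and the second inequality of (3,4') (l.664–678 / p.10), for
solutions:** for every domain, `ρ`, `T`, `μ ∈ [5/8, 3/4)` there are constants `b, c > 0` «independent on»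
the solution such that every solution of Problem 1 satisfies `w(t) ≤ f(t) + b(∫₀ᵗ (w + p)(t − τ)^{−μ}dτ)²`
and `∫₀ᵗ p² ≤ c∫₀ᵗ w²` for all `t ∈ (0,T]` (from Lemma 3.1, the Green-function bounds (2,9)–(2,10) and the
pressure estimate (2,17) of [12]; printed with «<», typed «≤», TYPING NOTES (iii)). The printed input of
Step 1. [cite: Bazarbekov2020, (3,2) l.614–627, (3,4') l.664–678] -/
def Step1a_Ineq32_34prime : Prop :=
  ∀ Ω : Set E3, IsSmoothDomain Ω → ∀ ρ T μ : ℝ, 0 < ρ → 0 < T → 5 / 8 ≤ μ → μ < 3 / 4 →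
    ∃ b c : ℝ, 0 < b ∧ 0 < c ∧ ∀ (f u : ℝ → E3 → E3) (p : ℝ → E3 → ℝ),
      AdmissibleForce Ω T f → SolvesIBVP Ω ρ T f 0 u p → ∀ t ∈ Ioc 0 T,
        wOf Ω f u t ≤ fOf Ω f t + b * (∫ τ in Ioo 0 t, (wOf Ω f u τ + pOf Ω p τ) * (t - τ) ^ (-μ)) ^ 2 ∧
        ∫ τ in Ioo 0 t, pOf Ω p τ ^ 2 ≤ c * ∫ τ in Ioo 0 t, wOf Ω f u τ ^ 2

/-- **Step 1b — (3,4'') AS PRINTED, abstract grain (l.679–691 / p.10):** «We shall prove by the second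
inequality of (3,4') [`∫₀ᵗ p²(τ)dτ < c·∫₀ᵗ w²(τ)dτ`] that there exists a constant `c > 0`:
`∫₀ᵗ p²(τ)(t − τ)^{−μ}dτ < c·∫₀ᵗ w²(τ)(t − τ)^{−μ}dτ` (3,4'')» — for all non-negative `p, w ∈ L₂(0,T)`
(the class named at l.645–650), the constant independent of `(p, w)` (it enters `b₁`, «independent on
function `w(t)`», l.656–658), `μ ∈ [5/8, 3/4)`; the printed argument is «by contradiction», applying
`J^{1−μ}`. The printed justification of Step 1; carried as a hypothesis of the composition.
[cite: Bazarbekov2020, (3,4'') l.679–691] -/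
def Step1b_Ineq34pp : Prop :=
  ∀ μ T c : ℝ, 5 / 8 ≤ μ → μ < 3 / 4 → 0 < T → 0 < c →
    ∃ c' : ℝ, 0 < c' ∧ ∀ p w : ℝ → ℝ, (∀ t, 0 ≤ p t) → (∀ t, 0 ≤ w t) →
      IntegrableOn (fun t => p t ^ 2) (Ioo 0 T) → IntegrableOn (fun t => w t ^ 2) (Ioo 0 T) →
      (∀ t ∈ Ioc 0 T, ∫ τ in Ioo 0 t, p τ ^ 2 < c * ∫ τ in Ioo 0 t, w τ ^ 2) →
        ∀ t ∈ Ioc 0 T,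
          ∫ τ in Ioo 0 t, p τ ^ 2 * (t - τ) ^ (-μ) < c' * ∫ τ in Ioo 0 t, w τ ^ 2 * (t - τ) ^ (-μ)

/-- **Step 1 — Lemma 3.2 (l.653–658 / p.10):** «From the estimates (2,17), (3,2) follows that:
`w(t) < f(t) + b₁·∫₀ᵗ w²(τ)(t − τ)^{−μ}dτ` (3.4) where `b₁ = b + c` is constant independent on function
`w(t)`» — for every solution of Problem 1, `μ ∈ [5/8, 3/4)` (typed «≤», TYPING NOTES (iii)).
[cite: Bazarbekov2020, Lemma 3.2 l.653–658] -/
def Step1_Lemma32 : Prop :=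
  ∀ Ω : Set E3, IsSmoothDomain Ω → ∀ ρ T μ : ℝ, 0 < ρ → 0 < T → 5 / 8 ≤ μ → μ < 3 / 4 →
    ∃ b₁ : ℝ, 0 < b₁ ∧ ∀ (f u : ℝ → E3 → E3) (p : ℝ → E3 → ℝ),
      AdmissibleForce Ω T f → SolvesIBVP Ω ρ T f 0 u p → ∀ t ∈ Ioc 0 T,
        wOf Ω f u t ≤ fOf Ω f t + b₁ * ∫ τ in Ioo 0 t, wOf Ω f u τ ^ 2 * (t - τ) ^ (-μ)

/-- **Step 2 — Theorem 3.1 (l.714–719 / p.11; proof l.720–1075 / pp.11–18), AS PRINTED, abstract grain:**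
«For all functions `w(t) ∈ L₂(0,T)` satisfying the inequality (3,4) the following estimate holds:
`‖w(t)‖_{L₂(0,T)} < √2·‖f(t)‖_{L₂(0,T)}` (3,5). This estimate does not depends on the number `b₁` in
(3,4).» — every `μ ∈ [5/8, 3/4)`, `b₁ > 0`, `T > 0`, all non-negative `w, f ∈ L₂(0,T)` ((3.2')).
[cite: Bazarbekov2020, Thm 3.1 l.714–719] -/
def Step2_Theorem31 : Prop :=
  ∀ μ b₁ T : ℝ, 5 / 8 ≤ μ → μ < 3 / 4 → 0 < b₁ → 0 < T →
    ∀ w f : ℝ → ℝ, (∀ t, 0 ≤ w t) → (∀ t, 0 ≤ f t) →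
      IntegrableOn (fun t => w t ^ 2) (Ioo 0 T) → IntegrableOn (fun t => f t ^ 2) (Ioo 0 T) →
      Ineq34 μ b₁ T w f → l2 T w < Real.sqrt 2 * l2 T f

/-- **Step 3 — Lemma 3.4 (l.1098–1168 / p.18–19: `K` compact on `L₂(Q_t)`) + the proof of Theorem 2.1
(l.1170–1216 / p.19–20):** «it follows by the Leray-Schauder's theorem in Proposition 6, that the basis
equation (2,20) has at least one solution `w ∈ L₂(Q_t)` and it follows from Theorem 3.1 that
`‖w‖_{L₂(Q_T)} ≤ √2·‖f‖_{L₂(Q_T)}`. Then, it follows by Proposition 8 that there exists the smooth solution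
`u ∈ W₂^{2,1}(Q_T) ∩ H₂(Q_t)`. But the Navier-Stokes problem has the unique smooth solution [3 p.139].»
Typed as the printed implication: the a-priori inequality (Step 1) and the a-priori estimate (Step 2)
yield Theorem 2.1. [cite: Bazarbekov2020, Lemma 3.4 l.1098–1168, proof of Thm 2.1 l.1170–1216] -/
def Step3_LeraySchauder : Prop := Step1_Lemma32 → Step2_Theorem31 → Theorem21

/-- **Step 4 — §4, proof of Theorem 4.1 (l.1258–1372 / p.21–22):** Hopf's weak solution (4.4), the heat
flow `u⁰` of the datum (4,5), the perturbed system (4.6)/(4,10), the inequality (4,11)–(4.12) «similarly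
… based on the proof of Lemma 3.2», then «From the Theorem 3.1, using this inequality, similarly we obtain
`‖w‖_{L₂(Q_T)} ≤ √2·c(T)·‖f_u‖_{L₂(Q_T)}` (4,13)», compactness of `(K_p + K₁)(E + P)` and «using
Lerau-Schauder's theorem and the estimate (4.13), the existence and smoothness … with `u(x,0) = a(x) ≠ 0`
is proved». Typed as the printed implication from Theorem 3.1 (Step 2) to Theorem 4.1.
[cite: Bazarbekov2020, §4 l.1258–1372] -/
def Step4_Section4 : Prop := Step2_Theorem31 → Theorem41

/-! ## Composition and Clay link -/

/-- COMPOSITION (PROVED) in the paper's own order: (3,2)/(3,4') (Step 1a) and (3,4'') (Step 1b) are the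
printed derivation of Lemma 3.2 (Step 1); Theorem 3.1 (Step 2) turns (3,4) into the a-priori estimate;
Leray–Schauder + Proposition 8 (Step 3) give Theorem 2.1; §4 (Step 4) gives Theorem 4.1 from
Theorem 3.1 again. Steps 1a, 1b are carried as hypotheses. [cite: Bazarbekov2020, §3–§4 l.583–1372] -/
theorem claim_of_steps (_h1a : Step1a_Ineq32_34prime) (_h1b : Step1b_Ineq34pp) (h1 : Step1_Lemma32)
    (h2 : Step2_Theorem31) (h3 : Step3_LeraySchauder) (h4 : Step4_Section4) : ClaimedTheorem :=
  ⟨h3 h1 h2, h4 h2⟩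

/-- THE CLAY DELTA as a named bridge (NOT printed, NOT asserted — recorded so that the map can cite the
exact gap): the claimed bounded-domain, forced theorems would have to imply Fefferman's (A).
Nothing in the text addresses Δ1–Δ3. [cite: Bazarbekov2020, Remark 2.1 l.223–234] -/
def ClayDelta : Prop := ClaimedTheorem → ClayVariants.clayR3.Regularity

/-- Under the (unprinted) bridge `ClayDelta` the claimed theorem would yield (A). Recorded, not asserted.
[cite: Bazarbekov2020, Remark 2.1 l.223–234] -/
theorem clay_of_claimed_of_delta (hΔ : ClayDelta) (h : ClaimedTheorem) :
    ClayVariants.clayR3.Regularity :=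
  hΔ h

end Literature.Claims.NS.Bazarbekov2020
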